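import Summits.QuantumFields.YangMills.Theorems.BalabanUVNodesN12AtTheta13OfThm1CCM
import Summits.QuantumFields.YangMills.Theorems.BalabanUVNodesN12AtRecord13SepCoPHSocketsPinned

/-!
# BalabanUVNodes ∕ N12 — THE K1⁷ v5 RUNG BODY AT THE DOOR-CURED COLLARED WITNESS `θ₁₅ᶜᶜᴹ(jM)` WITH THE [IV] LAYER PINNED AT THE LETTERS OF RECORD `λᴾ` (12W-H §2 instantiated at dag-n21-c's
# re-pinned K0⁷ witness; every witness-side fact discharged) — the kernel's which-child-blocks list for K1⁷ at the witness of record with N12 read at its layer of record (Track A, DAG node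
# N12 = [B15, Balaban1989LargeFieldI] CMP **122** (1989) 175–202; cluster K1 — K1⁷ `StabilityBAtRecordR13SepCoPH` = stmt-QuantumFields-20542, helper; seat `pub-ymgap-dag-n12-d` g13 (R134 s2),
# 2026-08-27; count-neutral, NOT a discharge)

HONEST FRAMING.  Count-neutral kernel INSTANTIATION BY NAME of 12W-H `…N12AtRecord13SepCoPHSocketsPinned` §2 (the ΛΩχZ-pinned v5 rung body at the door-cured pin of a live re-pin; N12 below the
torus by 12P's ★★ located row, N13 by dag-n11-e's v1.7 row) at `Θ := theta13OfNumerics … (stage12NumericsOfThm1CCM F.L jM …) …`, whose ₁₃ live re-pin IS dag-n21-c's collared witness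
`θ₁₅ᶜᶜᴹ(jM) = theta13OfThm1CCM F N jM ε₀ ε₂₉ B₃ B₃' a₀ a₁` (`rfl`): K0b's residuals (`hasResidualsOfRecord_theta13OfNumerics`), admissibility (`admissible_theta13OfNumerics` at
`stage12NumericsOfThm1CCM_pos`, six signs), the term-constant signs (12Y §3), `0 < M₂` (`M₂ = 1`, `rfl`) and `0 < M` (`M = L^{jM}`, `pow_pos`) are DISCHARGED; the K1-side input is the v1.5 package
`hP : Provisos₁₃SepCoP θ₁₅ᶜᶜᴹ(jM)` (its discharge from K0⁷'s R-road letters is 12Z `…N12AtTheta13OfThm1CCMOfStepR` §3).  The layer of record `λᴾ := (λ.pinRPrime₁₃ θ).pinD189ΛH ν A₁ M g σᶻ s N p₁`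
(dag-n12-e modules 16–19: 𝐑′, the (1.89) situation's regions `Λ ∕ cubes ∕ dist ∕ Z″ ∕ sides ∕ Ω₄-letters ∕ Ω″`, the levels `N₀`) leaves of `λ` only `kSel`, `LF` and the base situation's residual numbers free.
Nothing of Bałaban's is asserted; every printed fact is displayed; N12 is NOT discharged; no node is discharged; counts unmoved (discharged 5∕27 · Track A 5∕28).  ONE finite four-torus programme at fixed
`ε = L^{-K}` — nothing continuum ∕ ℝ⁴ ∕ OS ∕ mass gap ∕ Clay.
-/

noncomputable section

open MeasureTheory
open scoped Matrix.Norms.L2Operator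

namespace Summit.QuantumFields.YangMills.BalabanUVNodes.N12AtTheta13OfThm1CCMPinned

open Literature.MathematicalPhysics.QuantumFieldTheory.Balaban1983to89
open Literature.MathematicalPhysics.QuantumFieldTheory.Balaban1983to89.T4Continuum (T4Family)
open Literature.MathematicalPhysics.QuantumFieldTheory.Balaban1983to89.DagBinding
open Literature.MathematicalPhysics.QuantumFieldTheory.Balaban1983to89.Node00
open FlowStep (BetaLowerH BetaUpperH)
open FlowStepRuns (genFlow)
open B15Claim189Assembly (Setting189 new189 chiPP dom half)
open B15 (Prop1Printed Ineq180)
open B15.BasicStep (Claim189)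
open B15.PrelimIntegrations (Ineq191 Ineq195)
open B15Chi124DetSets (E124)
open B15DeterminingSets (MSField)
open B14DomainGeom (Pt)
open B8Eq17ClassAkV1 (plaqsOf)
open GaugeGroup (dist1)
open GaugeField (plaqHol)
open B15Claim189PrintedConditions (omegaOfChain)
open B15Claim189PinsOfHistory (sitOfHist N0OfRecord₁₃ D189OfHist)
open B15Claim189LambdaPin (enlD)
open B15RPrime1100OfRep (rPrimeDataOfSel)
open Summit.QuantumFields.YangMills.BalabanUVNodes.N12AtTheta13OfThm1CCM (kappa_nonneg_theta13OfThm1CCM E0_nonneg_theta13OfThm1CCM B0_nonneg_theta13OfThm1CCM)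
open Summit.QuantumFields.YangMills.BalabanUVNodes.N12AtRecord13SepCoPHSocketsPinned (nodesAtSomeRecordS₁₃SepCoPH_of_upS_fourPinW₀_pinnedΛΩχZ_ofHistoryBlind_ofCured_liveRepin₁₃_of_massLive_of_hasResiduals)

variable {N : ℕ} [NeZero N] {F : T4Family}

section PinnedAtCCM
variable (jM : ℕ) (ε₀ ε₂₉ B₃ B₃' a₀ a₁ : ℝ) (lam : ResidW F N) (σ : ∀ P : B12.RunParams, Sit189 F N P.K)
  (s : ∀ P : B12.RunParams, SeqOfRecord F (theta13OfThm1CCM F N jM ε₀ ε₂₉ B₃ B₃' a₀ a₁).ν (theta13OfThm1CCM F N jM ε₀ ε₂₉ B₃ B₃' a₀ a₁).τ9.M (gOfRecord₁₃ F N (theta13OfThm1CCM F N jM ε₀ ε₂₉ B₃ B₃' a₀ a₁) P) P.K (lam.kSel P + 1)) (Nm : B12.RunParams → ℕ) (p₁ : ℕ)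
  (Mstar : ℕ) (ops : OpsY N (theta13OfThm1CCM F N jM ε₀ ε₂₉ B₃ B₃' a₀ a₁).toStage3Params Mstar) (ζ : ResidZ F N) (W₀ : B12.RunParams → PrintedCarriers15) (w : WorldP)

/-- **★★★ THE K1⁷ v5 RUNG BODY AT THE DOOR-CURED COLLARED WITNESS `θ₁₅ᶜᶜᴹ(jM)` WITH THE [IV] LAYER PINNED AT THE LETTERS OF RECORD `λᴾ`** (12W-H §2 at `Θ := theta13OfNumerics … (stage12NumericsOfThm1CCM …) …`,
whose ₁₃ live re-pin IS `θ₁₅ᶜᶜᴹ(jM)` by `rfl`): K0b's residuals, admissibility (six witness signs), the three term-constant signs, `0 < M₂ = 1` and `0 < M = L^{jM}` ALL DISCHARGED; K1⁷-side input = `hP : Provisos₁₃SepCoP θ₁₅ᶜᶜᴹ(jM)`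
alone.  THE KERNEL's WHICH-CHILD-BLOCKS LIST FOR K1⁷ AT THE WITNESS OF RECORD WITH N12 READ AT ITS LAYER OF RECORD = this hypothesis list: the S-bound world `hC hγ hL hup`; N05 `h05S`, N06 `h06`, N07 `h07`, N08 `h08`,
N09 `h09` + `h09T`, N10 `h10`, N11 `h11`, (UV₁₃) `hUV`; the mixed pin `hW ∕ hWdeg` (K = 0 only) and `hsel`; and N12's located per-run inputs BELOW THE TORUS — live-mass `hmassLive` (NODE 00), Prop. 1 `hP1` at `λ.LF P`
(dag-n12-c via 12Q⁗), the levels `hlog ∕ hNN ∕ hNk`, the situation's residual numbers + print's p.200 conditions `hβ0 hβ hL₀ hL₀L hBB hδ hN₀ hMl` (reading `M = L^{jM}`), the flow inputs `hε0 hε1 hflow`, the run's window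
`hI` + β-sign leaf `hb hlow hγ1`, `hΛ`, the four ℍ-leaves + (1.80) `L91h L95 L91 L97 L80` (N07's objects).  COMPOSITE; nothing discharged as a node. [cite: Balaban1989LargeFieldII, Thm 1 p.355, (0.1) pp.355–356, p.391; Balaban1989LargeFieldI, (0.2)–(0.6) p.176, (1.2) p.178, (1.10)–(1.11) p.179, (1.73) p.192, Prop. 1 (1.78) p.194, (1.80) p.195, (1.89) p.198, (1.91)–(1.102) pp.199–201; Balaban1988Convergent, (2.1)–(2.8) pp.254–256, (2.17) p.257, (2.20)–(2.22) p.258, Thm 1 p.262, (3.16)–(3.25) pp.268–270; Balaban1987RG1, (0.20) p.256, (1.12) p.262; Balaban1985RegularSpaces, (1.3)–(1.6) p.77, Thm 8 p.101 (surviving form); Balaban1985Variational, Thm 1 p.279 (witness letters) (bookkeeping)] -/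
theorem nodesAtSomeRecordS₁₃SepCoPH_of_upS_fourPinW₀_pinnedΛΩχZ_ofHistoryBlind_ofCured_theta13OfThm1CCM_of_massLive
    (hε : 0 < ε₀) (hε' : 0 < ε₂₉) (hB : 0 ≤ B₃) (hB' : 0 ≤ B₃') (ha₀ : 0 < a₀) (ha₁ : 0 < a₁)
    (hP : (theta13OfThm1CCM F N jM ε₀ ε₂₉ B₃ B₃' a₀ a₁).Provisos₁₃SepCoP F N)
    -- the mixed W-pin AT THE LAYER OF RECORD λᴾ: below the torus `W₀ P` IS the bundle of record at λᴾ; elsewhere the closer's leaf-carrying `W₀ P`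
    (hW : ∀ P : B12.RunParams, lam.kSel P < P.K → W₀ P = WOfRecord₁₃ F N (theta13OfThm1CCM F N jM ε₀ ε₂₉ B₃ B₃' a₀ a₁)
      ((lam.pinRPrime₁₃ (theta13OfThm1CCM F N jM ε₀ ε₂₉ B₃ B₃' a₀ a₁)).pinD189ΛH (theta13OfThm1CCM F N jM ε₀ ε₂₉ B₃ B₃' a₀ a₁).ν (theta13OfThm1CCM F N jM ε₀ ε₂₉ B₃ B₃' a₀ a₁).A₁ (theta13OfThm1CCM F N jM ε₀ ε₂₉ B₃ B₃' a₀ a₁).τ9.M (gOfRecord₁₃ F N (theta13OfThm1CCM F N jM ε₀ ε₂₉ B₃ B₃' a₀ a₁))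
        (fun P => (((((σ P).pinZres (theta13OfThm1CCM F N jM ε₀ ε₂₉ B₃ B₃' a₀ a₁).ν (theta13OfThm1CCM F N jM ε₀ ε₂₉ B₃ B₃' a₀ a₁).τ9.M (gOfRecord₁₃ F N (theta13OfThm1CCM F N jM ε₀ ε₂₉ B₃ B₃' a₀ a₁) P) (s P) (N0OfRecord₁₃ (theta13OfThm1CCM F N jM ε₀ ε₂₉ B₃ B₃' a₀ a₁) P (lam.kSel P + 1))).pinSides (theta13OfThm1CCM F N jM ε₀ ε₂₉ B₃ B₃' a₀ a₁).ν (gOfRecord₁₃ F N (theta13OfThm1CCM F N jM ε₀ ε₂₉ B₃ B₃' a₀ a₁) P) (lam.kSel P + 1 - Nm P) (lam.kSel P + 1)).pinXΩ4 (s P) (enlD F (theta13OfThm1CCM F N jM ε₀ ε₂₉ B₃ B₃' a₀ a₁).ν (theta13OfThm1CCM F N jM ε₀ ε₂₉ B₃ B₃' a₀ a₁).τ9.M P (gOfRecord₁₃ F N (theta13OfThm1CCM F N jM ε₀ ε₂₉ B₃ B₃' a₀ a₁) P))).pinOmegaPP (s P) (Nm P) (enlD F (theta13OfThm1CCM F N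 jM ε₀ ε₂₉ B₃ B₃' a₀ a₁).ν (theta13OfThm1CCM F N jM ε₀ ε₂₉ B₃ B₃' a₀ a₁).τ9.M P (gOfRecord₁₃ F N (theta13OfThm1CCM F N jM ε₀ ε₂₉ B₃ B₃' a₀ a₁) P)))) s Nm p₁) P)
    (hWdeg : ∀ P : B12.RunParams, P.K ≤ lam.kSel P → B15Leaf (W₀ P))
    (hC : w.C = (datumOfRecord₁₃SepCoPH F N (Stage13HParams.ofHistoryBlind F N (Stage13RParams.ofCured F N (theta13OfThm1CCM F N jM ε₀ ε₂₉ B₃ B₃' a₀ a₁))) hP.ofCured.ofHistoryBlind).C) (hγ : 0 < w.γ ∧ w.γ ≤ (theta13OfThm1CCM F N jM ε₀ ε₂₉ B₃ B₃' a₀ a₁).γ) (hL : w.L = ((theta13OfThm1CCM F N jM ε₀ ε₂₉ B₃ B₃' a₀ a₁).L : ℝ))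
    (hup : ∀ P, w.up P = upOfRecord₅CS F N ((((((Stage13HParams.ofHistoryBlind F N (Stage13RParams.ofCured F N (theta13OfThm1CCM F N jM ε₀ ε₂₉ B₃ B₃' a₀ a₁))).toStage5₁₃CoPH F N).pinB10 F N).pinY F N (Y9OfRecord N (theta13OfThm1CCM F N jM ε₀ ε₂₉ B₃ B₃' a₀ a₁).toStage3Params Mstar ops)).pinZ F N (Z11OfRecord F N ζ)).pinW F N W₀) P)
    (h05S : ∀ P : B12.RunParams, (upOfRecord₅CS F N ((((((Stage13HParams.ofHistoryBlind F N (Stage13RParams.ofCured F N (theta13OfThm1CCM F N jM ε₀ ε₂₉ B₃ B₃' a₀ a₁))).toStage5₁₃CoPH F N).pinB10 F N).pinY F N (Y9OfRecord N (theta13OfThm1CCM F N jM ε₀ ε₂₉ B₃ B₃' a₀ a₁).toStage3Params Mstar ops)).pinZ F N (Z11OfRecord F N ζ)).pinW F N W₀) P).b8)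
    (h06 : B9LeafX (Y9OfRecord N (theta13OfThm1CCM F N jM ε₀ ε₂₉ B₃ B₃' a₀ a₁).toStage3Params Mstar ops))
    (h07 : B11Leaf (Z11OfRecord F N ζ))
    (h08 : PrintedUV3V N (theta13OfThm1CCM F N jM ε₀ ε₂₉ B₃ B₃' a₀ a₁).L)
    (h09 : ∀ P : B12.RunParams, B12Sec2to5.Lemma4Printed ((theta13OfThm1CCM F N jM ε₀ ε₂₉ B₃ B₃' a₀ a₁).res.X P).F12 ((theta13OfThm1CCM F N jM ε₀ ε₂₉ B₃ B₃' a₀ a₁).res.X P).c12)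
    (h09T : ∀ P : B12.RunParams, (leavesP w P).smallCouplings → (leavesP w P).smallFieldInductive)
    (h10 : ∀ P : B12.RunParams, B9LeafX (Y9OfRecord N (theta13OfThm1CCM F N jM ε₀ ε₂₉ B₃ B₃' a₀ a₁).toStage3Params Mstar ops) →
      (B10.Thm1PrintedCompact (((((((Stage13HParams.ofHistoryBlind F N (Stage13RParams.ofCured F N (theta13OfThm1CCM F N jM ε₀ ε₂₉ B₃ B₃' a₀ a₁))).toStage5₁₃CoPH F N).pinB10 F N).pinY F N (Y9OfRecord N (theta13OfThm1CCM F N jM ε₀ ε₂₉ B₃ B₃' a₀ a₁).toStage3Params Mstar ops)).pinZ F N (Z11OfRecord F N ζ)).pinW F N W₀).res.X P).runs10 ∧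
          B10.Thm2Printed (((((((Stage13HParams.ofHistoryBlind F N (Stage13RParams.ofCured F N (theta13OfThm1CCM F N jM ε₀ ε₂₉ B₃ B₃' a₀ a₁))).toStage5₁₃CoPH F N).pinB10 F N).pinY F N (Y9OfRecord N (theta13OfThm1CCM F N jM ε₀ ε₂₉ B₃ B₃' a₀ a₁).toStage3Params Mstar ops)).pinZ F N (Z11OfRecord F N ζ)).pinW F N W₀).res.X P).runs10) →
        B11Leaf (Z11OfRecord F N ζ) → B12Sec2to5.Lemma4Printed ((theta13OfThm1CCM F N jM ε₀ ε₂₉ B₃ B₃' a₀ a₁).res.X P).F12 ((theta13OfThm1CCM F N jM ε₀ ε₂₉ B₃ B₃' a₀ a₁).res.X P).c12 →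
          B13.Lemma1Printed ((theta13OfThm1CCM F N jM ε₀ ε₂₉ B₃ B₃' a₀ a₁).res.X P).S13 ((theta13OfThm1CCM F N jM ε₀ ε₂₉ B₃ B₃' a₀ a₁).res.X P).c13 ∧ B13.Lemma2Printed ((theta13OfThm1CCM F N jM ε₀ ε₂₉ B₃ B₃' a₀ a₁).res.X P).S13 ((theta13OfThm1CCM F N jM ε₀ ε₂₉ B₃ B₃' a₀ a₁).res.X P).c13 ∧
            B13.Lemma3Printed ((theta13OfThm1CCM F N jM ε₀ ε₂₉ B₃ B₃' a₀ a₁).res.X P).S13 ((theta13OfThm1CCM F N jM ε₀ ε₂₉ B₃ B₃' a₀ a₁).res.X P).c13)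
    (h11 : ∀ P : B12.RunParams, (leavesP w P).b7 → (leavesP w P).b8 → (leavesP w P).b9 → (leavesP w P).b10 → (leavesP w P).b11 →
      (leavesP w P).smallCouplings → (leavesP w P).smallFieldInductive → (leavesP w P).flowControl →
        ∀ k, k < P.K → SLaw₁₃CoPH F N (Stage13HParams.ofHistoryBlind F N (Stage13RParams.ofCured F N (theta13OfThm1CCM F N jM ε₀ ε₂₉ B₃ B₃' a₀ a₁))) P k → TLaw₁₃CoPH F N (Stage13HParams.ofHistoryBlind F N (Stage13RParams.ofCured F N (theta13OfThm1CCM F N jM ε₀ ε₂₉ B₃ B₃' a₀ a₁))) P k)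
    (hUV : ∀ P : B12.RunParams, (genFlow (betaOfRecord₁₃ F N (theta13OfThm1CCM F N jM ε₀ ε₂₉ B₃ B₃' a₀ a₁)) P.g0).InInterval w.γ P.K → ∀ k, k ≤ P.K → SLaw₁₃CoPH F N (Stage13HParams.ofHistoryBlind F N (Stage13RParams.ofCured F N (theta13OfThm1CCM F N jM ε₀ ε₂₉ B₃ B₃' a₀ a₁))) P k →
      ∀ U : GaugeField (F.P P.K) k (SU N),
        chiβOfRecord₁₃ F N (theta13OfThm1CCM F N jM ε₀ ε₂₉ B₃ B₃' a₀ a₁) P.K (gOfRecord₁₃ F N (theta13OfThm1CCM F N jM ε₀ ε₂₉ B₃ B₃' a₀ a₁) P) k U *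
              Real.exp (-(1 / (gOfRecord₁₃ F N (theta13OfThm1CCM F N jM ε₀ ε₂₉ B₃ B₃' a₀ a₁) P k) ^ 2 * wilsonBGOfRecord F N (theta13OfThm1CCM F N jM ε₀ ε₂₉ B₃ B₃' a₀ a₁).εbg P k U)
                - w.em (gOfRecord₁₃ F N (theta13OfThm1CCM F N jM ε₀ ε₂₉ B₃ B₃' a₀ a₁) P k) * (Fintype.card (Site (F.P P.K) k) : ℝ)) ≤ densOfRecord₁₃ F N (theta13OfThm1CCM F N jM ε₀ ε₂₉ B₃ B₃' a₀ a₁) P k U ∧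
        densOfRecord₁₃ F N (theta13OfThm1CCM F N jM ε₀ ε₂₉ B₃ B₃' a₀ a₁) P k U ≤ Real.exp (w.ep (gOfRecord₁₃ F N (theta13OfThm1CCM F N jM ε₀ ε₂₉ B₃ B₃' a₀ a₁) P k) * (Fintype.card (Site (F.P P.K) k) : ℝ)))
    -- N12 AT THE LAYER OF RECORD: 12P's located per-run inputs, run by run, BELOW THE TORUS ONLY (`D P` abbreviates the pinned (1.89) setting `λᴾ.D189 P`)
    (D : ∀ P : B12.RunParams, Setting189 (F.P P.K) (SU N) (MSField (F.P P.K) (SU N) × ((j : ℕ) → VecField (F.P P.K) j (EuclideanSpace ℝ (Fin (N ^ 2 - 1))))) (Pt (F.P P.K).d))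
    (hD : ∀ P : B12.RunParams, D P = ((lam.pinRPrime₁₃ (theta13OfThm1CCM F N jM ε₀ ε₂₉ B₃ B₃' a₀ a₁)).pinD189ΛH (theta13OfThm1CCM F N jM ε₀ ε₂₉ B₃ B₃' a₀ a₁).ν (theta13OfThm1CCM F N jM ε₀ ε₂₉ B₃ B₃' a₀ a₁).A₁ (theta13OfThm1CCM F N jM ε₀ ε₂₉ B₃ B₃' a₀ a₁).τ9.M (gOfRecord₁₃ F N (theta13OfThm1CCM F N jM ε₀ ε₂₉ B₃ B₃' a₀ a₁)) (fun P => (((((σ P).pinZres (theta13OfThm1CCM F N jM ε₀ ε₂₉ B₃ B₃' a₀ a₁).ν (theta13OfThm1CCM F N jM ε₀ ε₂₉ B₃ B₃' a₀ a₁).τ9.M (gOfRecord₁₃ F N (theta13OfThm1CCM F N jM ε₀ ε₂₉ B₃ B₃' a₀ a₁) P) (s P) (N0OfRecord₁₃ (theta13OfThm1CCM F N jM ε₀ ε₂₉ B₃ B₃' a₀ a₁) P (lam.kSel P + 1))).pinSides (theta13OfThm1CCM F N jM ε₀ ε₂₉ B₃ B₃' a₀ a₁).ν (gOfRecord₁₃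 F N (theta13OfThm1CCM F N jM ε₀ ε₂₉ B₃ B₃' a₀ a₁) P) (lam.kSel P + 1 - Nm P) (lam.kSel P + 1)).pinXΩ4 (s P) (enlD F (theta13OfThm1CCM F N jM ε₀ ε₂₉ B₃ B₃' a₀ a₁).ν (theta13OfThm1CCM F N jM ε₀ ε₂₉ B₃ B₃' a₀ a₁).τ9.M P (gOfRecord₁₃ F N (theta13OfThm1CCM F N jM ε₀ ε₂₉ B₃ B₃' a₀ a₁) P))).pinOmegaPP (s P) (Nm P) (enlD F (theta13OfThm1CCM F N jM ε₀ ε₂₉ B₃ B₃' a₀ a₁).ν (theta13OfThm1CCM F N jM ε₀ ε₂₉ B₃ B₃' a₀ a₁).τ9.M P (gOfRecord₁₃ F N (theta13OfThm1CCM F N jM ε₀ ε₂₉ B₃ B₃' a₀ a₁) P)))) s Nm p₁).D189 P)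
    (hmassLive : ∀ P : B12.RunParams, lam.kSel P < P.K → ∀ a, LiveSeq F N (theta13OfThm1CCM F N jM ε₀ ε₂₉ B₃ B₃' a₀ a₁).ν (theta13OfThm1CCM F N jM ε₀ ε₂₉ B₃ B₃' a₀ a₁).τ9 P (gOfRecord₁₃ F N (theta13OfThm1CCM F N jM ε₀ ε₂₉ B₃ B₃' a₀ a₁) P) (lam.kSel P + 1)
        (slotsTOfRecord F N (theta13OfThm1CCM F N jM ε₀ ε₂₉ B₃ B₃' a₀ a₁).ν (theta13OfThm1CCM F N jM ε₀ ε₂₉ B₃ B₃' a₀ a₁).τ9 (EOfRecord₁₃ F N (theta13OfThm1CCM F N jM ε₀ ε₂₉ B₃ B₃' a₀ a₁)) (wOfRecord₉ F N (theta13OfThm1CCM F N jM ε₀ ε₂₉ B₃ B₃' a₀ a₁).toStage9Params)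
          (theta13OfThm1CCM F N jM ε₀ ε₂₉ B₃ B₃' a₀ a₁).ppSel P (gOfRecord₁₃ F N (theta13OfThm1CCM F N jM ε₀ ε₂₉ B₃ B₃' a₀ a₁) P) (lam.kSel P + 1)) a →
      0 < ∫ V, rterm (reprTOfRecord₁₃ F N (theta13OfThm1CCM F N jM ε₀ ε₂₉ B₃ B₃' a₀ a₁) P (lam.kSel P)) a V ∂(fieldMeasure (F.P P.K) (lam.kSel P + 1) (SU N)))
    (hP1 : ∀ P : B12.RunParams, lam.kSel P < P.K → Prop1Printed (lam.LF P))
    (hlog : ∀ P : B12.RunParams, lam.kSel P < P.K → 1 < (Real.log (gOfRecord₁₃ F N (theta13OfThm1CCM F N jM ε₀ ε₂₉ B₃ B₃' a₀ a₁) P (lam.kSel P + 1) ^ 2)⁻¹) ^ (theta13OfThm1CCM F N jM ε₀ ε₂₉ B₃ B₃' a₀ a₁).ν.r)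
    (hNN : ∀ P : B12.RunParams, lam.kSel P < P.K → N0OfRecord₁₃ (theta13OfThm1CCM F N jM ε₀ ε₂₉ B₃ B₃' a₀ a₁) P (lam.kSel P + 1) ≤ Nm P)
    (hNk : ∀ P : B12.RunParams, lam.kSel P < P.K → N0OfRecord₁₃ (theta13OfThm1CCM F N jM ε₀ ε₂₉ B₃ B₃' a₀ a₁) P (lam.kSel P + 1) ≤ lam.kSel P + 1)
    (hβ0 : ∀ P : B12.RunParams, lam.kSel P < P.K → 0 ≤ (σ P).β)
    (hβ : ∀ P : B12.RunParams, lam.kSel P < P.K → (σ P).β ≤ 1 / 4)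
    (hL₀ : ∀ P : B12.RunParams, lam.kSel P < P.K → 2 ≤ (σ P).L₀)
    (hL₀L : ∀ P : B12.RunParams, lam.kSel P < P.K → (σ P).L₀ ^ 2 ≤ ((F.P P.K).L : ℝ))
    (hBB : ∀ P : B12.RunParams, lam.kSel P < P.K → 0 ≤ (σ P).O1 * (σ P).B₃ * (σ P).B₅)
    (hδ : ∀ P : B12.RunParams, lam.kSel P < P.K → 0 ≤ (σ P).δ)
    (hN₀ : ∀ P : B12.RunParams, lam.kSel P < P.K → (2 + (121 / 120) ^ 2 * ((σ P).O1 * (σ P).B₃ * (σ P).B₅ * ((theta13OfThm1CCM F N jM ε₀ ε₂₉ B₃ B₃' a₀ a₁).τ9.M : ℝ) ^ 5)) *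
      ((((σ P).L₀ ^ 2) ^ (N0OfRecord₁₃ (theta13OfThm1CCM F N jM ε₀ ε₂₉ B₃ B₃' a₀ a₁) P (lam.kSel P + 1) - 1))⁻¹) ≤ 1 / 4)
    (hMl : ∀ P : B12.RunParams, lam.kSel P < P.K → (121 / 120) ^ 2 * ((σ P).O1 * (σ P).B₃ * (σ P).B₅ * ((theta13OfThm1CCM F N jM ε₀ ε₂₉ B₃ B₃' a₀ a₁).τ9.M : ℝ) ^ 5) * Real.exp (-(4 * (σ P).δ * ((theta13OfThm1CCM F N jM ε₀ ε₂₉ B₃ B₃' a₀ a₁).τ9.M : ℝ))) ≤ 1 / 12)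
    (hε0 : ∀ P : B12.RunParams, lam.kSel P < P.K → ∀ i, lam.kSel P + 1 - Nm P ≤ i → i ≤ lam.kSel P + 1 → 0 ≤ epsOfRecord (theta13OfThm1CCM F N jM ε₀ ε₂₉ B₃ B₃' a₀ a₁).ν (gOfRecord₁₃ F N (theta13OfThm1CCM F N jM ε₀ ε₂₉ B₃ B₃' a₀ a₁) P) i)
    (hε1 : ∀ P : B12.RunParams, lam.kSel P < P.K → ∀ i, lam.kSel P + 1 - Nm P ≤ i → i ≤ lam.kSel P + 1 → epsOfRecord (theta13OfThm1CCM F N jM ε₀ ε₂₉ B₃ B₃' a₀ a₁).ν (gOfRecord₁₃ F N (theta13OfThm1CCM F N jM ε₀ ε₂₉ B₃ B₃' a₀ a₁) P) i ≤ 1 / 10)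
    {β₀ : ℝ}
    (hβ₀0 : 0 ≤ β₀)
    (hβ₀ : β₀ ≤ 1 / 2)
    (hflow : ∀ P : B12.RunParams, lam.kSel P < P.K → ∀ j, lam.kSel P + 1 - Nm P ≤ j → j < lam.kSel P + 1 → epsOfRecord (theta13OfThm1CCM F N jM ε₀ ε₂₉ B₃ B₃' a₀ a₁).ν (gOfRecord₁₃ F N (theta13OfThm1CCM F N jM ε₀ ε₂₉ B₃ B₃' a₀ a₁) P) (lam.kSel P + 1)
      ≤ (1 + β₀) * Real.sqrt ((lam.kSel P + 1 - j : ℕ) : ℝ) * epsOfRecord (theta13OfThm1CCM F N jM ε₀ ε₂₉ B₃ B₃' a₀ a₁).ν (gOfRecord₁₃ F N (theta13OfThm1CCM F N jM ε₀ ε₂₉ B₃ B₃' a₀ a₁) P) j)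
    {b γ : ℝ}
    (hb : 0 ≤ b)
    (hlow : BetaLowerH b γ (betaOfRecord₁₃ F N (theta13OfThm1CCM F N jM ε₀ ε₂₉ B₃ B₃' a₀ a₁)))
    (hγ1 : γ ≤ 1)
    (hI : ∀ P : B12.RunParams, lam.kSel P < P.K → Step.InInterval γ P.K (gOfRecord₁₃ F N (theta13OfThm1CCM F N jM ε₀ ε₂₉ B₃ B₃' a₀ a₁) P))
    (hΛ : ∀ P : B12.RunParams, lam.kSel P < P.K → (((enlD F (theta13OfThm1CCM F N jM ε₀ ε₂₉ B₃ B₃' a₀ a₁).ν (theta13OfThm1CCM F N jM ε₀ ε₂₉ B₃ B₃' a₀ a₁).τ9.M P (gOfRecord₁₃ F N (theta13OfThm1CCM F N jM ε₀ ε₂₉ B₃ B₃' a₀ a₁) P)) 4 (lam.kSel P + 1 + 1 - (N0OfRecord₁₃ (theta13OfThm1CCM F N jM ε₀ ε₂₉ B₃ B₃' a₀ a₁) P (lam.kSel P + 1)))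
        (omegaOfChain (s P) (lam.kSel P + 1 + 1 - (N0OfRecord₁₃ (theta13OfThm1CCM F N jM ε₀ ε₂₉ B₃ B₃' a₀ a₁) P (lam.kSel P + 1)))))ᶜ ∩ (σ P).Z).Nonempty)
    (L91h : ∀ P : B12.RunParams, lam.kSel P < P.K → ∀ U, new189 (D P) U → ∀ p ∈ plaqsOf (half (D P)),
      Ineq191 (dist1 (plaqHol ((D P).Upp U) p)) ((D P).devV'' U p) (D P).α (((D P).L ^ (D P).h)⁻¹) ((D P).ε (D P).h) (E124 (D P).ε (D P).L (D P).η (D P).k (D P).h))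
    (L95 : ∀ P : B12.RunParams, lam.kSel P < P.K → ∀ U, new189 (D P) U → ∀ p ∈ plaqsOf (half (D P)),
      Ineq195 ((D P).devV'' U p) (dist1 (plaqHol ((D P).Uhalf U ((D P).boxOf p)) p)) (D P).α (((D P).L ^ (D P).h)⁻¹) ((D P).ε (D P).h) (E124 (D P).ε (D P).L (D P).η (D P).k (D P).h))
    (L91 : ∀ P : B12.RunParams, lam.kSel P < P.K → ∀ U, new189 (D P) U → ∀ j, (D P).h ≤ j → j ≤ (D P).k → ∀ p ∈ plaqsOf (dom (D P) j),
      Ineq191 (dist1 (plaqHol ((D P).Upp U) p)) ((D P).dev97 U p) (D P).α (((D P).L ^ j)⁻¹) ((D P).ε j) (E124 (D P).ε (D P).L (D P).η (D P).k j))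
    (L97 : ∀ P : B12.RunParams, lam.kSel P < P.K → ∀ U, new189 (D P) U → ∀ j, (D P).h ≤ j → j ≤ (D P).k → ∀ p ∈ plaqsOf (dom (D P) j),
      Ineq191 ((D P).dev97 U p) ((D P).dev0 U p) (D P).α (((D P).L ^ j)⁻¹) ((D P).ε j) (E124 (D P).ε (D P).L (D P).η (D P).k j))
    (L80 : ∀ P : B12.RunParams, lam.kSel P < P.K → ∀ U, new189 (D P) U → ∀ j, (D P).h ≤ j → j ≤ (D P).k → ∀ p ∈ plaqsOf (dom (D P) j),
      Ineq180 ((D P).dev0 U p) ((D P).ε (D P).k) (D P).η (D P).B₃ (D P).B₅ (D P).M (D P).δ ((D P).dist p) (D P).O1)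
    (hsel : ∀ P : B12.RunParams, 1 ≤ P.K → lam.kSel P < P.K) :
    ∃ (θ' : Stage13HParams F N) (h' : θ'.Provisos₁₃SepCoPH F N) (w : WorldP), (θ'.ZhUnity F N ∧ θ'.SlotsNondegenerate₁₃ F N) ∧ θ'.Admissible F N ∧
      (∃ (θ'' : Stage13HParams F N) (h'' : θ''.Provisos₁₃SepCoPH F N), θ''.Admissible F N ∧
        datumOfRecord₁₃SepCoPH F N θ' h' = datumOfRecord₁₃SepCoPH F N θ'' h'' ∧ w.C = (datumOfRecord₁₃SepCoPH F N θ' h').C ∧ (0 < w.γ ∧ w.γ ≤ θ''.γ) ∧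
        w.L = (θ''.L : ℝ) ∧ ∀ P : B12.RunParams, w.up P = upOfRecord₅CS F N (θ''.toStage5₁₃CoPH F N) P) ∧
      (∀ P : B12.RunParams, Nodes (leavesP w P)) ∧ PrintedUV3V N θ'.L ∧
      ∃ lam : ResidW F N, (∀ P : B12.RunParams, 1 ≤ P.K → lam.kSel P < P.K) ∧
        ∀ P : B12.RunParams, lam.kSel P < P.K → ((leavesP w P).rBasicStep ↔ B15Leaf (WOfRecord₁₃ F N θ'.toStage13Params lam P)) :=
  nodesAtSomeRecordS₁₃SepCoPH_of_upS_fourPinW₀_pinnedΛΩχZ_ofHistoryBlind_ofCured_liveRepin₁₃_of_massLive_of_hasResiduals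
    (theta13OfNumerics F N (stage12NumericsOfThm1CCM F.L jM ε₀ B₃ B₃' a₀ a₁) ε₂₉ (zeta316OfRecord F N (stage12NumericsOfThm1CCM F.L jM ε₀ B₃ B₃' a₀ a₁).ν (stage12NumericsOfThm1CCM F.L jM ε₀ B₃ B₃' a₀ a₁).τ9.M (stage12NumericsOfThm1CCM F.L jM ε₀ B₃ B₃' a₀ a₁).A₁) (RzOfRecord F N) (ZtOfRecord F N)) lam σ s Nm p₁ Mstar ops ζ W₀ w
    (hasResidualsOfRecord_theta13OfNumerics F N (stage12NumericsOfThm1CCM F.L jM ε₀ B₃ B₃' a₀ a₁) ε₂₉) hP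
    (admissible_theta13OfNumerics F N (zeta316OfRecord F N (stage12NumericsOfThm1CCM F.L jM ε₀ B₃ B₃' a₀ a₁).ν (stage12NumericsOfThm1CCM F.L jM ε₀ B₃ B₃' a₀ a₁).τ9.M (stage12NumericsOfThm1CCM F.L jM ε₀ B₃ B₃' a₀ a₁).A₁) (RzOfRecord F N) (ZtOfRecord F N) (stage12NumericsOfThm1CCM_pos F.hL.2.le hε hB hB' ha₀ ha₁) hε')
    (kappa_nonneg_theta13OfThm1CCM F N jM ε₀ ε₂₉ B₃ B₃' a₀ a₁) (E0_nonneg_theta13OfThm1CCM F N jM ε₀ ε₂₉ B₃ B₃' a₀ a₁) (B0_nonneg_theta13OfThm1CCM F N jM ε₀ ε₂₉ B₃ B₃' a₀ a₁)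
    hW hWdeg hC hγ hL hup h05S h06 h07 h08 h09 h09T h10 h11 hUV
    Nat.one_pos -- `M₂ = 1` at the collared member (`theta13OfThm1CCM_M₂`, `rfl`)
    (pow_pos (Nat.zero_lt_of_lt F.hL.2) jM) -- `M = L^{jM} > 0`
    D hD hmassLive hP1 hlog hNN hNk hβ0 hβ hL₀ hL₀L hBB hδ hN₀ hMl hε0 hε1 hβ₀0 hβ₀ hflow hb hlow hγ1 hI hΛ L91h L95 L91 L97 L80 hsel

end PinnedAtCCM

end Summit.QuantumFields.YangMills.BalabanUVNodes.N12AtTheta13OfThm1CCMPinned
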